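import Summits.Ventures.DiscreteObjects.Hadamard.PrimeOrderSummary668B
import Summits.Ventures.DiscreteObjects.Hadamard.ElemAbelianSummary668C
import Summits.Ventures.DiscreteObjects.Hadamard.Order49Excluded668
import Summits.Ventures.DiscreteObjects.Hadamard.Order25FifthPowerFixed668
import Summits.Ventures.DiscreteObjects.Hadamard.ElemAbelianRank2FixedGram

/-!
# Hadamard 668 census, family F12 — the ODD part of the signed automorphism group of an H(668) in ONE statement
# (kernel summary; the group-theoretic reading is marked as a paper step)

Framing: lottery ticket; floor = certified bounds/negative ranges.

Cell pub-namedobj (venture DiscreteObjects), target (H), hadamard gen 18 (lead item H14-4).  Let `H` be a Hadamard matrix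
of order `668` and consider its signed-permutation automorphisms `(π, κ, d, e)` (`H (π i) (κ j) = d i · e j · H i j`,
`IsSignedAut`).  **`hadamard668_aut_structure_summary`** is the conjunction of the following KERNEL statements:
1. PRIME SPECTRUM: if `π^p = κ^p = 1`, `(π, κ) ≠ (1,1)`, `p` prime, then `p ∈ {2,3,5,7,11,13,23,37,41,83,167}`
   (`hadamard668_signedAut_prime_mem'`, gens 4–8); order form `hadamard668_signedAut_prime_dvd_orderOf`:
   a prime dividing `orderOf (π, κ)` lies in that set.
2. PRIME SQUARES: for every prime `p ≥ 7`, `p² ∤ orderOf (π, κ)` (`hadamard668_signedAut_not_dvd_orderOf_sq` for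
   `p ≥ 11`, gen 11; `hadamard668_signedAut_not_dvd_orderOf_49`, gen 18; other primes `≥ 7` do not divide the order at
   all by 1.).
3. RANK 2: for every prime `p ≥ 7` there are no two signed automorphisms of exponent `p` with commuting permutation
   parts and independent row parts (`⟨α, β⟩ ≅ C_p × C_p`; `no_hadamard668_elemAbelian_rank2_ge7`, gens 16–17).
4. STRUCTURE AT `5` AND `3` (no exclusion): pair-order `25` ⇒ `#Fix π = #Fix κ ∈ {8, 18}` and the fifth powers fix
   exactly `68` rows and `68` columns (`hadamard668_order25_fixed_eq`, `hadamard668_order25_pow5_fixed`); `C₅ × C₅` ⇒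
   the rows and columns fixed by the whole group are equinumerous, `8` or `18` (`hadamard668_rank2_5_fixedAll_eq`);
   pair-order `9` ⇒ `#Fix π = #Fix κ ≡ 2 (mod 6)`, `≤ 74` (`hadamard668_order9_fixed_eq`); `C₃ × C₃` ⇒ group-fixed rows
   and columns equinumerous, `≡ 2 (mod 6)`, `≤ 74` (`hadamard668_rank2_3_fixedAll_eq`).
5. COMPOSITE ORDERS: `p·q ∤ orderOf (π, κ)` for the 31 prime pairs of `hadamard668_signedAut_not_dvd_orderOf` (gen 11;
   the six further pairs 143, 91, 111, 123, 65, 77 have kernel STRUCTURE statements in `CompositeOrderStructure668(B)`,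
   gen 17, and 15, 21, 33, 35, 39, 55, 69 are open — not restated here).
PAPER STEP (group theory, NOT a kernel statement; dictionary `SignedAutDictionary`, gen 17: in a subgroup of odd order
of the signed automorphism group the map to row permutations is injective): from 1.–3., for every prime `p ≥ 7` a
Sylow `p`-subgroup of Aut± H(668) has exponent `p` and no `C_p × C_p`, hence order `1` or `p`; so the odd part of
`|Aut± H(668)|` divides `3^a · 5^b · 7 · 11 · 13 · 23 · 37 · 41 · 83 · 167` for some `a, b`, with the `5`- and
`3`-parts constrained only by 4.  NOTHING here excludes H(668) or asserts that any automorphism exists; HITS 0/4.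
Ours, not literature; no `sorry`, no definitions, default heartbeats.
-/

namespace Summit.Ventures.DiscreteObjects.Hadamard

open Finset BigOperators Matrix

open Literature.Combinatorics.Designs.GoethalsSeidel (IsHadamardMatrix)

variable {ι : Type*} [Fintype ι] [DecidableEq ι]

section orderforms
variable {H : Matrix ι ι ℤ}

/-- **Order form of the prime spectrum.**  A prime dividing the order of the permutation pair of a signed
automorphism of an H(668) lies in `{2, 3, 5, 7, 11, 13, 23, 37, 41, 83, 167}`. -/
theorem hadamard668_signedAut_prime_dvd_orderOf (hH : IsHadamardMatrix H) (hι : Fintype.card ι = 668)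
    (π κ : Equiv.Perm ι) (d e : ι → ℤ) (haut : IsSignedAut H π κ d e) {p : ℕ} (hp : p.Prime)
    (hdvd : p ∣ orderOf ((π, κ) : Equiv.Perm ι × Equiv.Perm ι)) :
    p ∈ ({2, 3, 5, 7, 11, 13, 23, 37, 41, 83, 167} : Finset ℕ) := by
  set x : Equiv.Perm ι × Equiv.Perm ι := (π, κ) with hx
  have hx0 : orderOf x ≠ 0 := (orderOf_pos x).ne'
  set k := orderOf x / p with hk
  have hord : orderOf (x ^ k) = p := orderOf_pow_orderOf_div hx0 hdvd
  have hxk : x ^ k = ((π ^ k, κ ^ k) : Equiv.Perm ι × Equiv.Perm ι) := by rw [hx, Prod.pow_mk]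
  rw [hxk] at hord
  obtain ⟨h1, h2, h3⟩ := pow_data_of_orderOf hord (a := 1) one_pos hp.one_lt
  rw [pow_one, pow_one] at h3
  exact hadamard668_signedAut_prime_mem' hH hι p hp (π ^ k) (κ ^ k) _ _ (isSignedAut_pow haut k) h1 h2 h3

/-- **Prime squares, all primes `≥ 7`.**  For every signed automorphism of an H(668) and every prime `p ≥ 7`:
`p² ∤ orderOf (π, κ)`. -/
theorem hadamard668_signedAut_not_dvd_orderOf_sq_ge7 (hH : IsHadamardMatrix H) (hι : Fintype.card ι = 668)
    (π κ : Equiv.Perm ι) (d e : ι → ℤ) (haut : IsSignedAut H π κ d e) {p : ℕ} (hp : p.Prime) (hp7 : 7 ≤ p)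
    (hdvd : p * p ∣ orderOf ((π, κ) : Equiv.Perm ι × Equiv.Perm ι)) : False := by
  have hmem := hadamard668_signedAut_prime_dvd_orderOf hH hι π κ d e haut hp (dvd_trans (dvd_mul_right p p) hdvd)
  simp only [Finset.mem_insert, Finset.mem_singleton] at hmem
  rcases hmem with h | h | h | h | h
  · omega
  · omega
  · omega
  · subst h; exact hadamard668_signedAut_not_dvd_orderOf_49 hH hι π κ d e haut hdvd
  · exact hadamard668_signedAut_not_dvd_orderOf_sq hH hι π κ d e haut h hdvd

end orderforms

/-- **The odd part of Aut± H(668): kernel summary** (see the module docstring for the numbered items and for the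
paper-step boundary). -/
theorem hadamard668_aut_structure_summary {H : Matrix ι ι ℤ} (hH : IsHadamardMatrix H)
    (hι : Fintype.card ι = 668) :
    -- 1. prime spectrum (exponent form and order form)
    (∀ (p : ℕ), p.Prime → ∀ (π κ : Equiv.Perm ι) (d e : ι → ℤ), IsSignedAut H π κ d e →
      π ^ p = 1 → κ ^ p = 1 → (π ≠ 1 ∨ κ ≠ 1) → p ∈ ({2, 3, 5, 7, 11, 13, 23, 37, 41, 83, 167} : Finset ℕ)) ∧
    (∀ (p : ℕ), p.Prime → ∀ (π κ : Equiv.Perm ι) (d e : ι → ℤ), IsSignedAut H π κ d e →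
      p ∣ orderOf ((π, κ) : Equiv.Perm ι × Equiv.Perm ι) →
      p ∈ ({2, 3, 5, 7, 11, 13, 23, 37, 41, 83, 167} : Finset ℕ)) ∧
    -- 2. prime squares, p ≥ 7
    (∀ (p : ℕ), p.Prime → 7 ≤ p → ∀ (π κ : Equiv.Perm ι) (d e : ι → ℤ), IsSignedAut H π κ d e →
      ¬ p * p ∣ orderOf ((π, κ) : Equiv.Perm ι × Equiv.Perm ι)) ∧
    -- 3. no C_p × C_p, p ≥ 7
    (∀ (p : ℕ), p.Prime → 7 ≤ p → ∀ {α α' β β' : Equiv.Perm ι} {d₁ e₁ d₂ e₂ : ι → ℤ},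
      IsSignedAut H α α' d₁ e₁ → IsSignedAut H β β' d₂ e₂ → α ^ p = 1 → α' ^ p = 1 → β ^ p = 1 → β' ^ p = 1 →
      Commute α β → Commute α' β' → (∀ a b : ℕ, a < p → b < p → α ^ a * β ^ b = 1 → a = 0 ∧ b = 0) → False) ∧
    -- 4a. order 25
    (∀ (π κ : Equiv.Perm ι) (d e : ι → ℤ), IsSignedAut H π κ d e → π ^ 25 = 1 → κ ^ 25 = 1 →
      (π ^ 5 ≠ 1 ∨ κ ^ 5 ≠ 1) →
      (univ.filter fun i => π i = i).card = (univ.filter fun j => κ j = j).card ∧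
      ((univ.filter fun j => κ j = j).card = 8 ∨ (univ.filter fun j => κ j = j).card = 18) ∧
      (univ.filter fun i => (π ^ 5) i = i).card = 68 ∧ (univ.filter fun j => (κ ^ 5) j = j).card = 68) ∧
    -- 4b. C₅ × C₅
    (∀ {α α' β β' : Equiv.Perm ι} {d₁ e₁ d₂ e₂ : ι → ℤ},
      IsSignedAut H α α' d₁ e₁ → IsSignedAut H β β' d₂ e₂ → α ^ 5 = 1 → α' ^ 5 = 1 → β ^ 5 = 1 → β' ^ 5 = 1 →
      Commute α β → Commute α' β' → (∀ a b : ℕ, a < 5 → b < 5 → α ^ a * β ^ b = 1 → a = 0 ∧ b = 0) →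
      (univ.filter fun x => α x = x ∧ β x = x).card = (univ.filter fun y => α' y = y ∧ β' y = y).card ∧
      ((univ.filter fun y => α' y = y ∧ β' y = y).card = 8 ∨
        (univ.filter fun y => α' y = y ∧ β' y = y).card = 18)) ∧
    -- 4c. order 9
    (∀ (π κ : Equiv.Perm ι) (d e : ι → ℤ), IsSignedAut H π κ d e → π ^ 9 = 1 → κ ^ 9 = 1 →
      (π ^ 3 ≠ 1 ∨ κ ^ 3 ≠ 1) →
      (univ.filter fun i => π i = i).card = (univ.filter fun j => κ j = j).card ∧
      (univ.filter fun j => κ j = j).card % 6 = 2 ∧ (univ.filter fun j => κ j = j).card ≤ 74) ∧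
    -- 4d. C₃ × C₃
    (∀ {α α' β β' : Equiv.Perm ι} {d₁ e₁ d₂ e₂ : ι → ℤ},
      IsSignedAut H α α' d₁ e₁ → IsSignedAut H β β' d₂ e₂ → α ^ 3 = 1 → α' ^ 3 = 1 → β ^ 3 = 1 → β' ^ 3 = 1 →
      Commute α β → Commute α' β' → (∀ a b : ℕ, a < 3 → b < 3 → α ^ a * β ^ b = 1 → a = 0 ∧ b = 0) →
      (univ.filter fun x => α x = x ∧ β x = x).card = (univ.filter fun y => α' y = y ∧ β' y = y).card ∧
      (univ.filter fun y => α' y = y ∧ β' y = y).card % 6 = 2 ∧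
      (univ.filter fun y => α' y = y ∧ β' y = y).card ≤ 74) ∧
    -- 5. composite orders (the 31 excluded prime pairs)
    (∀ (π κ : Equiv.Perm ι) (d e : ι → ℤ), IsSignedAut H π κ d e →
      ∀ pq ∈ ([(5, 23), (7, 23), (11, 23)] ++
        [(5, 37), (7, 37), (11, 37), (7, 41), (11, 41), (3, 83), (5, 83), (7, 83), (11, 83), (3, 167), (5, 167),
          (7, 167), (11, 167)] ++
        [(13, 23), (13, 37), (13, 41), (13, 83), (13, 167), (23, 37), (23, 41), (23, 83), (23, 167),
          (37, 41), (37, 83), (37, 167), (41, 83), (41, 167), (83, 167)] : List (ℕ × ℕ)),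
        ¬ pq.1 * pq.2 ∣ orderOf ((π, κ) : Equiv.Perm ι × Equiv.Perm ι)) := by
  refine ⟨?_, ?_, ?_, ?_, ?_, ?_, ?_, ?_, ?_⟩
  · intro p hp π κ d e haut hπ hκ hne
    exact hadamard668_signedAut_prime_mem' hH hι p hp π κ d e haut hπ hκ hne
  · intro p hp π κ d e haut hdvd
    exact hadamard668_signedAut_prime_dvd_orderOf hH hι π κ d e haut hp hdvd
  · intro p hp hp7 π κ d e haut hdvd
    exact hadamard668_signedAut_not_dvd_orderOf_sq_ge7 hH hι π κ d e haut hp hp7 hdvd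
  · intro p hp hp7 α α' β β' d₁ e₁ d₂ e₂ hA hB hα hα' hβ hβ' hc hc' hind
    exact no_hadamard668_elemAbelian_rank2_ge7 hH hι p hp hp7 hA hB hα hα' hβ hβ' hc hc' hind
  · intro π κ d e haut hπ hκ hne
    obtain ⟨heq, h818⟩ := hadamard668_order25_fixed_eq hH hι π κ d e haut hπ hκ hne
    obtain ⟨hR68, hC68⟩ := hadamard668_order25_pow5_fixed hH hι π κ d e haut hπ hκ hne
    exact ⟨heq, h818, hR68, hC68⟩
  · intro α α' β β' d₁ e₁ d₂ e₂ hA hB hα hα' hβ hβ' hc hc' hind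
    exact hadamard668_rank2_5_fixedAll_eq hH hι hA hB hα hα' hβ hβ' hc hc' hind
  · intro π κ d e haut hπ hκ hne
    exact hadamard668_order9_fixed_eq hH hι π κ d e haut hπ hκ hne
  · intro α α' β β' d₁ e₁ d₂ e₂ hA hB hα hα' hβ hβ' hc hc' hind
    exact hadamard668_rank2_3_fixedAll_eq hH hι hA hB hα hα' hβ hβ' hc hc' hind
  · intro π κ d e haut
    exact hadamard668_signedAut_not_dvd_orderOf hH hι π κ d e haut

end Summit.Ventures.DiscreteObjects.Hadamard
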